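import Literature.NumberTheory.LFunctions.SiegelZeroClassNumberAllConductors
import Literature.NumberTheory.LFunctions.SiegelZeroClassNumberAllConductorsEven
import Literature.NumberTheory.QuadraticFields.EffectiveClassNumberLowerBoundProofs
import Literature.NumberTheory.QuadraticFields.RealQuadraticOddNarrowClassNumber
import HarnessLib

/-!
# The exceptional conductor has few prime factors: `2^{ω(q)} ≤ (2/π) √q log²q (1 − β)` at a real
# zero of an ODD real primitive character — genus theory under the kernel I.1 line (PROVED, debt 0)

Topic `Literature/NumberTheory/LFunctions` (namespace `Literature.NumberTheory.LFunctions`, sub-namespace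
`SiegelZeroClassNumber`; continuing `SiegelZeroClassNumberAllConductors.lean`). Everything here is PROVED
(theorems only; no definition, no named fact). Cell `parity-realchar` (SIEGEL INSTRUMENT, conditionals
column, topic I.1 «class numbers» — an arithmetic READING of the I.1 upper bound, and a kernel refinement
of the effective repulsion of TARGET §2 row 16 by the genus factor `2^{ω(q)−1}`).

For an odd real primitive `χ` mod `q` the exceptional field `K`, `d_K = −q`, has `2`-rank `ω(q) − 1`
(Gauss's genus theory: `#Cl_K[2] = 2^{t−1}`, `t = ω(|d_K|)`; tree `Quadratic.card_sq_eq_one_classGroup`,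
`two_pow_le_classNumber`: `2^{t−1} ≤ h_K`), while a real zero `β` of `L(s,χ)` close to `1` makes `h_K`
small (`SiegelZeroClassNumber.classNumber_le_of_odd`: `h_K ≤ (1/π) √q log²q (1 − β)`, kernel form of
Montgomery–Vaughan (11.10) with the class number formula). Eliminating `h_K` gives CHARACTER-side
statements with no field in them:

* `two_pow_card_primeFactors_le_of_odd` — **`2^{ω(q)} ≤ (2/π) √q log²q (1 − β)`** (`q ≥ 232`, window
  `1/(40 log q)`); `…_quarter` — `≤ (110/π) √q log²q (1 − β)` (`q ≥ 8`, window `1/(4 log q)`);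
* `one_sub_realZero_ge_two_pow_min_of_odd` — the REPULSION gains the genus factor:
  **`1 − β ≥ min (1/(40 log q)) (π 2^{ω(q)}/(2 √q log²q))`** for every real zero of every odd real primitive
  `χ` mod `q ≥ 232` (compare `RealZeroRepulsion.one_sub_realZero_ge_pi`: `π/(√q log²q)`-type, `ω`-free);
* `two_pow_card_primeFactors_le_of_isSiegelZero_odd` — on the column's predicate: a Siegel zero of quality
  `η` at an odd `χ` mod `q ≥ 10⁴` forces **`2^{ω(q)} ≤ (110/π) √q log q/η`**; `…_of_forty_le`:
  `2^{ω(q)} ≤ (2/π) √q log q/η` for `η ≥ 40`. In words: the better the Siegel zero, the closer the exceptional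
  conductor is to a prime (for `η ≍ √q`, `ω(q) ≤ log₂ log q + O(1)`).

(The even column would need the `2`-rank of the class group of a REAL quadratic field, `ω(q) − 1` or
`ω(q) − 2`; not in the tree in that form — left as `-- TODO(even column)`.)

LABEL (cell rule): instrument (kernel) / conditionals I.1 reading. WHAT THIS IS NOT: no claim that a real zero
exists; nothing here bears on parity (H5).

## References

* [Cox2013] §3.B Proposition 3.11, Theorem 3.15 (genus theory: `2^{t−1}` ambiguous classes).
* [GrossZagier1986] §I.8 p. 232 («`2^{t−1}` divides `h(D)` by genus theory», as used by the tree).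
* [MontgomeryVaughan2007] §11.2 Theorem 11.4 (11.10); §9.3 Theorem 9.13.
* [TaoTeravainen2021] Definition 1.4 (`IsSiegelZero`).
-/

noncomputable section

open Complex
open Literature.Barriers.Parity
open Literature.NumberTheory.QuadraticFields Literature.NumberTheory.QuadraticFields.Quadratic
open _root_.NumberField _root_.NumberField.Units Module

namespace Literature.NumberTheory.LFunctions

namespace SiegelZeroClassNumber

/-- `log q ≥ 9` for `q ≥ 10⁴`. [folklore] -/
private theorem nine_le_log'' {q : ℕ} (hq : 10 ^ 4 ≤ q) : (9 : ℝ) ≤ Real.log q := by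
  have hq' : (10 : ℝ) ^ 4 ≤ q := by exact_mod_cast hq
  rw [Real.le_log_iff_exp_le (by linarith)]
  have h1 : Real.exp 9 = Real.exp 1 ^ 9 := by rw [← Real.exp_nat_mul]; norm_num
  rw [h1]
  calc Real.exp 1 ^ 9 ≤ 2.7182818286 ^ 9 :=
        pow_le_pow_left₀ (Real.exp_pos 1).le Real.exp_one_lt_d9.le 9
    _ ≤ (10 : ℝ) ^ 4 := by norm_num
    _ ≤ q := hq'

/-- **Genus theory, conductor side:** for any quadratic field `K` with `d_K = −q`, `q ≥ 2`:
`2^{ω(q)} ≤ 2 h_K`. [cite: Cox2013, §3.B Theorem 3.15] [cite: GrossZagier1986, §I.8 p. 232] -/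
theorem two_pow_card_primeFactors_le_two_mul_classNumber {q : ℕ} {K : Type*} [Field K] [NumberField K]
    (h2 : finrank ℚ K = 2) (hdK : NumberField.discr K = -(q : ℤ)) (hq : 2 ≤ q) :
    (2 : ℝ) ^ q.primeFactors.card ≤ 2 * (classNumber K : ℝ) := by
  have hd : NumberField.discr K < 0 := by
    rw [hdK, neg_lt_zero]; exact_mod_cast (show 0 < q by omega)
  have hIQ : Literature.NumberTheory.EllipticCurves.IsImaginaryQuadratic K :=
    Literature.NumberTheory.EllipticCurves.isImaginaryQuadratic_iff_discr_neg.mpr ⟨h2, hd⟩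
  have hgen := two_pow_le_classNumber hIQ
  have hnat : (NumberField.discr K).natAbs = q := by rw [hdK]; simp
  rw [hnat] at hgen
  have ht : 1 ≤ q.primeFactors.card :=
    Finset.card_pos.mpr (Nat.nonempty_primeFactors.mpr (by omega))
  have hgenR : (2 : ℝ) ^ (q.primeFactors.card - 1) ≤ (classNumber K : ℝ) := by exact_mod_cast hgen
  calc (2 : ℝ) ^ q.primeFactors.card = 2 * 2 ^ (q.primeFactors.card - 1) := by
        rw [← pow_succ', Nat.sub_add_cancel ht]
    _ ≤ 2 * (classNumber K : ℝ) := by linarith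

variable {q : ℕ} [NeZero q] {χ : DirichletCharacter ℂ q}

/-- **`2^{ω(q)} ≤ (2/π) √q log²q (1 − β)` (kernel, fact-free).** For an odd real primitive `χ` mod `q ≥ 232`
and a real zero `β ≥ 1 − 1/(40 log q)` of `L(s,χ)`: the exceptional field `K` (`d_K = −q`) exists, has
`2^{ω(q)−1} ≤ h_K` (genus theory) and `h_K ≤ (1/π) √q log²q (1 − β)` (kernel I.1).
[cite: Cox2013, §3.B Theorem 3.15] [cite: MontgomeryVaughan2007, §11.2 (11.10)] -/
theorem two_pow_card_primeFactors_le_of_odd (hq : 232 ≤ q) (hprim : χ.IsPrimitive)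
    (hquad : χ.IsQuadratic) (hodd : χ.Odd) {β : ℝ} (hβ : 1 - 1 / (40 * Real.log q) ≤ β)
    (hz : χ.LFunction β = 0) :
    (2 : ℝ) ^ q.primeFactors.card ≤ 2 / Real.pi * Real.sqrt q * Real.log q ^ 2 * (1 - β) := by
  obtain ⟨K, _, _, h2, hdK⟩ := exists_field_of_odd hprim hquad hodd
  have hgen := two_pow_card_primeFactors_le_two_mul_classNumber h2 hdK (by omega)
  have hup := classNumber_le_of_odd h2 hdK hq hprim hquad hodd hβ hz
  calc (2 : ℝ) ^ q.primeFactors.card ≤ 2 * (classNumber K : ℝ) := hgen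
    _ ≤ 2 * (1 / Real.pi * Real.sqrt q * Real.log q ^ 2 * (1 - β)) := by linarith
    _ = 2 / Real.pi * Real.sqrt q * Real.log q ^ 2 * (1 - β) := by ring

/-- **`2^{ω(q)} ≤ (110/π) √q log²q (1 − β)` on the wider window `1/(4 log q)` (`q ≥ 8`).**
[cite: Cox2013, §3.B Theorem 3.15] [cite: MontgomeryVaughan2007, §11.2 (11.10)] -/
theorem two_pow_card_primeFactors_le_of_odd_quarter (hq : 8 ≤ q) (hprim : χ.IsPrimitive)
    (hquad : χ.IsQuadratic) (hodd : χ.Odd) {β : ℝ} (hβ : 1 - 1 / (4 * Real.log q) ≤ β)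
    (hz : χ.LFunction β = 0) :
    (2 : ℝ) ^ q.primeFactors.card ≤ 110 / Real.pi * Real.sqrt q * Real.log q ^ 2 * (1 - β) := by
  obtain ⟨K, _, _, h2, hdK⟩ := exists_field_of_odd hprim hquad hodd
  have hgen := two_pow_card_primeFactors_le_two_mul_classNumber h2 hdK (by omega)
  have hup := classNumber_le_of_odd_quarter h2 hdK hq hprim hquad hodd hβ hz
  calc (2 : ℝ) ^ q.primeFactors.card ≤ 2 * (classNumber K : ℝ) := hgen
    _ ≤ 2 * (55 / Real.pi * Real.sqrt q * Real.log q ^ 2 * (1 - β)) := by linarith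
    _ = 110 / Real.pi * Real.sqrt q * Real.log q ^ 2 * (1 - β) := by ring

/-- **Repulsion with the genus factor (kernel):** every real zero `β` of an odd real primitive `χ` mod
`q ≥ 232` satisfies **`1 − β ≥ min (1/(40 log q)) (π 2^{ω(q)} / (2 √q log²q))`** — either it is outside the
window `1/(40 log q)`, or the previous bound applies. For `ω(q)` large this beats the `ω`-free kernel
repulsion `RealZeroRepulsion.one_sub_realZero_ge_pi` by the factor `2^{ω(q)−1}`.
[cite: Cox2013, §3.B Theorem 3.15] [cite: MontgomeryVaughan2007, §11.2 (11.10)] -/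
theorem one_sub_realZero_ge_two_pow_min_of_odd (hq : 232 ≤ q) (hprim : χ.IsPrimitive)
    (hquad : χ.IsQuadratic) (hodd : χ.Odd) {β : ℝ} (hz : χ.LFunction β = 0) :
    min (1 / (40 * Real.log q)) (Real.pi * 2 ^ q.primeFactors.card / (2 * Real.sqrt q * Real.log q ^ 2))
      ≤ 1 - β := by
  by_cases hβ : 1 - 1 / (40 * Real.log q) ≤ β
  · have h := two_pow_card_primeFactors_le_of_odd hq hprim hquad hodd hβ hz
    have hsqrt : (0 : ℝ) < Real.sqrt q := Real.sqrt_pos.mpr (by exact_mod_cast (show 0 < q by omega))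
    have hL0 : 0 < Real.log q := Real.log_pos (by exact_mod_cast (show 1 < q by omega))
    have hpi := Real.pi_pos
    refine le_trans (min_le_right _ _) ?_
    rw [div_le_iff₀ (by positivity)]
    rw [show 2 / Real.pi * Real.sqrt q * Real.log q ^ 2 * (1 - β) =
        (1 - β) * (2 * Real.sqrt q * Real.log q ^ 2) / Real.pi by ring, le_div_iff₀ hpi] at h
    linarith
  · rw [not_le] at hβ
    exact le_trans (min_le_left _ _) (by linarith)

/-- **A Siegel zero of quality `η` forces `2^{ω(q)} ≤ (110/π) √q log q/η`** (kernel; odd `χ` mod `q ≥ 10⁴`,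
`η ≥ 10`, window `1/(4 log q)`): the exceptional conductor has at most `log₂((110/π) √q log q/η)` prime
factors. [cite: TaoTeravainen2021, Definition 1.4] [cite: Cox2013, §3.B Theorem 3.15]
[cite: MontgomeryVaughan2007, §11.2 (11.10)] -/
theorem two_pow_card_primeFactors_le_of_isSiegelZero_odd (hq : 10 ^ 4 ≤ q) {η : ℝ}
    (hS : IsSiegelZero χ η) (hodd : χ.Odd) :
    (2 : ℝ) ^ q.primeFactors.card ≤ 110 / Real.pi * Real.sqrt q * Real.log q / η := by
  obtain ⟨hprim, hquad, h10, hzero⟩ := hS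
  have hL9 := nine_le_log'' hq
  have hL0 : 0 < Real.log q := by linarith
  have hη0 : 0 < η := by linarith
  set β : ℝ := 1 - 1 / (η * Real.log q) with hβdef
  have hκ : 1 - β = 1 / (η * Real.log q) := by rw [hβdef]; ring
  have hβ4 : 1 - 1 / (4 * Real.log q) ≤ β := by
    have : 1 / (η * Real.log q) ≤ 1 / (4 * Real.log q) :=
      one_div_le_one_div_of_le (by positivity) (mul_le_mul_of_nonneg_right (by linarith) hL0.le)
    rw [hβdef]; linarith
  have h := two_pow_card_primeFactors_le_of_odd_quarter (le_trans (by norm_num) hq) hprim hquad hodd hβ4 hzero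
  rw [hκ] at h
  calc (2 : ℝ) ^ q.primeFactors.card
      ≤ 110 / Real.pi * Real.sqrt q * Real.log q ^ 2 * (1 / (η * Real.log q)) := h
    _ = 110 / Real.pi * Real.sqrt q * Real.log q / η := by field_simp

/-- **Quality `η ≥ 40`: `2^{ω(q)} ≤ (2/π) √q log q/η`** (odd `χ` mod `q ≥ 10⁴`).
[cite: TaoTeravainen2021, Definition 1.4] [cite: Cox2013, §3.B Theorem 3.15]
[cite: MontgomeryVaughan2007, §11.2 (11.10)] -/
theorem two_pow_card_primeFactors_le_of_isSiegelZero_odd_of_forty_le (hq : 10 ^ 4 ≤ q) {η : ℝ}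
    (hS : IsSiegelZero χ η) (hodd : χ.Odd) (h40 : 40 ≤ η) :
    (2 : ℝ) ^ q.primeFactors.card ≤ 2 / Real.pi * Real.sqrt q * Real.log q / η := by
  obtain ⟨hprim, hquad, -, hzero⟩ := hS
  have hL9 := nine_le_log'' hq
  have hL0 : 0 < Real.log q := by linarith
  have hη0 : 0 < η := by linarith
  set β : ℝ := 1 - 1 / (η * Real.log q) with hβdef
  have hκ : 1 - β = 1 / (η * Real.log q) := by rw [hβdef]; ring
  have hβ40 : 1 - 1 / (40 * Real.log q) ≤ β := by
    have : 1 / (η * Real.log q) ≤ 1 / (40 * Real.log q) :=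
      one_div_le_one_div_of_le (by positivity) (mul_le_mul_of_nonneg_right h40 hL0.le)
    rw [hβdef]; linarith
  have h := two_pow_card_primeFactors_le_of_odd (le_trans (by norm_num) hq) hprim hquad hodd hβ40 hzero
  rw [hκ] at h
  calc (2 : ℝ) ^ q.primeFactors.card
      ≤ 2 / Real.pi * Real.sqrt q * Real.log q ^ 2 * (1 / (η * Real.log q)) := h
    _ = 2 / Real.pi * Real.sqrt q * Real.log q / η := by field_simp

-- TODO(even column): the `2`-rank of the class group of a REAL quadratic field (`ω(q) − 1` or `ω(q) − 2`,
-- according as all prime factors of `q` are `≡ 1 (mod 4)` or not) would give the analogue for even `χ`.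

/-! ### Appended (rc-cond g11): the EVEN column through NARROW genus theory — `2^{ω(q)−1} ∣ h⁺_K ≤ 2 h_K`

The TODO above is discharged in the weaker-by-`2` form that the tree supports today: for a real quadratic field
the narrow class number satisfies `2^{t−1} ∣ h⁺_K` (Fröhlich–Taylor V §1, tree
`Quadratic.two_pow_card_primeFactors_discr_sub_one_dvd_narrowClassNumber`) and `h⁺_K ∈ {h_K, 2h_K}` (tree
`narrowClassNumber_eq_classNumber_iff_exists_norm_neg` / `narrowClassNumber_eq_two_mul_classNumber_iff`), so
`2^{ω(q)} ≤ 4 h_K`; with the even-column bound `h_K ≤ 1.2 √q log q (1 − β)` of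
`SiegelZeroClassNumber.classNumber_le_of_even_explicit` this gives `2^{ω(q)} ≤ 4.8 √q log q (1 − β)` — one
logarithm BETTER than the odd column, again because `R_K ≫ log q`. -/

open Literature.NumberTheory.NumberFields in
/-- **Narrow genus theory, conductor side:** for any quadratic field `K` with `d_K = q > 1` (real quadratic),
`2^{ω(q)} ≤ 4 h_K` (`2^{ω(q)−1} ∣ h⁺_K` and `h⁺_K ≤ 2 h_K`). [cite: FrohlichTaylor1990, Ch. V §1 (1.14) and the
remark before Thm. 41, pp. 164, 170] -/
theorem two_pow_card_primeFactors_le_four_mul_classNumber {q : ℕ} {K : Type} [Field K] [NumberField K]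
    (h2 : finrank ℚ K = 2) (hdK : NumberField.discr K = (q : ℤ)) (hq : 2 ≤ q) :
    (2 : ℝ) ^ q.primeFactors.card ≤ 4 * (classNumber K : ℝ) := by
  have hd : 0 < NumberField.discr K := by rw [hdK]; exact_mod_cast (show 0 < q by omega)
  haveI : IsTotallyReal K :=
    NumberField.nrComplexPlaces_eq_zero_iff.mp
      (nrRealPlaces_eq_two_and_nrComplexPlaces_eq_zero h2 hd).2
  have hdvd := two_pow_card_primeFactors_discr_sub_one_dvd_narrowClassNumber (L := K) h2
  have hnat : (NumberField.discr K).natAbs = q := by rw [hdK]; simp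
  rw [hnat] at hdvd
  have hh : 0 < classNumber K := classNumber_pos K
  -- `h⁺ ≤ 2h` and `h⁺ > 0`
  have hle : narrowClassNumber K ≤ 2 * classNumber K ∧ 0 < narrowClassNumber K := by
    rcases Literature.Geometry.Kaehler.ComplexTorus.narrowClassNumber_eq_or_eq_two_mul (K := K) h2 with h | h
    · rw [h]; exact ⟨by omega, hh⟩
    · rw [h]; exact ⟨le_rfl, by omega⟩
  have hgen : 2 ^ (q.primeFactors.card - 1) ≤ narrowClassNumber K := Nat.le_of_dvd hle.2 hdvd
  have ht : 1 ≤ q.primeFactors.card :=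
    Finset.card_pos.mpr (Nat.nonempty_primeFactors.mpr (by omega))
  have hgenR : (2 : ℝ) ^ (q.primeFactors.card - 1) ≤ (narrowClassNumber K : ℝ) := by exact_mod_cast hgen
  have hleR : (narrowClassNumber K : ℝ) ≤ 2 * (classNumber K : ℝ) := by exact_mod_cast hle.1
  calc (2 : ℝ) ^ q.primeFactors.card = 2 * 2 ^ (q.primeFactors.card - 1) := by
        rw [← pow_succ', Nat.sub_add_cancel ht]
    _ ≤ 2 * (narrowClassNumber K : ℝ) := by linarith
    _ ≤ 4 * (classNumber K : ℝ) := by linarith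

/-- **`2^{ω(q)} ≤ 4.8 √q log q (1 − β)` (kernel, fact-free; EVEN column).** For an even real primitive `χ` mod
`q ≥ 4096` and a real zero `β ≥ 1 − 1/(40 log q)` of `L(s,χ)`: the real quadratic field `K` (`d_K = q`) exists,
`2^{ω(q)} ≤ 4 h_K` (narrow genus theory) and `h_K ≤ 1.2 √q log q (1 − β)` (even column of kernel I.1).
[cite: FrohlichTaylor1990, Ch. V §1, pp. 164, 170] [cite: MontgomeryVaughan2007, §11.2 (11.10)] -/
theorem two_pow_card_primeFactors_le_of_even (hq : 4096 ≤ q) (hprim : χ.IsPrimitive)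
    (hquad : χ.IsQuadratic) (heven : χ.Even) {β : ℝ} (hβ : 1 - 1 / (40 * Real.log q) ≤ β)
    (hz : χ.LFunction β = 0) :
    (2 : ℝ) ^ q.primeFactors.card ≤ 4.8 * Real.sqrt q * Real.log q * (1 - β) := by
  obtain ⟨K, _, _, h2, hdK⟩ := exists_field_of_even (by omega) hprim hquad heven
  have hgen := two_pow_card_primeFactors_le_four_mul_classNumber h2 hdK (by omega)
  have hup := classNumber_le_of_even_explicit h2 hdK hq hprim hquad heven hβ hz
  calc (2 : ℝ) ^ q.primeFactors.card ≤ 4 * (classNumber K : ℝ) := hgen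
    _ ≤ 4 * (1.2 * Real.sqrt q * Real.log q * (1 - β)) := by linarith
    _ = 4.8 * Real.sqrt q * Real.log q * (1 - β) := by ring

/-- **Repulsion with the genus factor, EVEN column (kernel):** every real zero `β` of an even real primitive `χ`
mod `q ≥ 4096` satisfies **`1 − β ≥ min (1/(40 log q)) (2^{ω(q)} / (4.8 √q log q))`**.
[cite: FrohlichTaylor1990, Ch. V §1, pp. 164, 170] [cite: MontgomeryVaughan2007, §11.2 (11.10)] -/
theorem one_sub_realZero_ge_two_pow_min_of_even (hq : 4096 ≤ q) (hprim : χ.IsPrimitive)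
    (hquad : χ.IsQuadratic) (heven : χ.Even) {β : ℝ} (hz : χ.LFunction β = 0) :
    min (1 / (40 * Real.log q)) (2 ^ q.primeFactors.card / (4.8 * Real.sqrt q * Real.log q)) ≤ 1 - β := by
  by_cases hβ : 1 - 1 / (40 * Real.log q) ≤ β
  · have h := two_pow_card_primeFactors_le_of_even hq hprim hquad heven hβ hz
    have hsqrt : (0 : ℝ) < Real.sqrt q := Real.sqrt_pos.mpr (by exact_mod_cast (show 0 < q by omega))
    have hL0 : 0 < Real.log q := Real.log_pos (by exact_mod_cast (show 1 < q by omega))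
    refine le_trans (min_le_right _ _) ?_
    rw [div_le_iff₀ (by positivity)]
    linarith
  · rw [not_le] at hβ
    exact le_trans (min_le_left _ _) (by linarith)

/-- **A Siegel zero of quality `η ≥ 40` at an EVEN `χ` mod `q ≥ 10⁴` forces `2^{ω(q)} ≤ 4.8 √q/η`** (kernel):
`2^{ω(q)} ≤ 4 h_K` and `h_K ≤ 1.2 √q/η` (`SiegelZeroClassNumber.classNumber_le_of_isSiegelZero_even_of_forty_le`).
[cite: TaoTeravainen2021, Definition 1.4] [cite: FrohlichTaylor1990, Ch. V §1, pp. 164, 170]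
[cite: MontgomeryVaughan2007, §11.2 (11.10)] -/
theorem two_pow_card_primeFactors_le_of_isSiegelZero_even_of_forty_le (hq : 10 ^ 4 ≤ q) {η : ℝ}
    (hS : IsSiegelZero χ η) (heven : χ.Even) (h40 : 40 ≤ η) :
    (2 : ℝ) ^ q.primeFactors.card ≤ 4.8 * Real.sqrt q / η := by
  obtain ⟨K, _, _, h2, hdK⟩ := exists_field_of_even (by omega) hS.1 hS.2.1 heven
  have hgen := two_pow_card_primeFactors_le_four_mul_classNumber h2 hdK (by omega)
  have hup := classNumber_le_of_isSiegelZero_even_of_forty_le h2 hdK hq hS heven h40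
  have hη0 : 0 < η := by linarith
  rw [le_div_iff₀ hη0] at hup ⊢
  nlinarith

/-- **Quality `η ≥ 10`: `2^{ω(q)} ≤ 264 √q/η`** at an even `χ` mod `q ≥ 10⁴` (`4 · 66`, via
`SiegelZeroClassNumber.classNumber_le_of_isSiegelZero_even`). [cite: TaoTeravainen2021, Definition 1.4]
[cite: FrohlichTaylor1990, Ch. V §1, pp. 164, 170] [cite: MontgomeryVaughan2007, §11.2 (11.10)] -/
theorem two_pow_card_primeFactors_le_of_isSiegelZero_even (hq : 10 ^ 4 ≤ q) {η : ℝ}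
    (hS : IsSiegelZero χ η) (heven : χ.Even) :
    (2 : ℝ) ^ q.primeFactors.card ≤ 264 * Real.sqrt q / η := by
  obtain ⟨K, _, _, h2, hdK⟩ := exists_field_of_even (by omega) hS.1 hS.2.1 heven
  have hgen := two_pow_card_primeFactors_le_four_mul_classNumber h2 hdK (by omega)
  have hup := classNumber_le_of_isSiegelZero_even h2 hdK hq hS heven
  have hη0 : 0 < η := by linarith [hS.2.2.1]
  rw [le_div_iff₀ hη0] at hup ⊢
  nlinarith

end SiegelZeroClassNumber

end Literature.NumberTheory.LFunctions

end
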